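import Summits.ValiantsHypothesis.ValiantsHypothesis.Theorems.BarrierLeverChowBenchmarkPairsPeelRows

/-!
# Route BarrierLever — item 22038 `ChowBenchmarkPairs`, line `moore-peel`: the typed node
# CONJECTURE HAAR («the segment functionals are a Haar system on the code segments» — total nonsingularity
# of the row family on every initial segment of the binary codes), its kernel arrow to `stub_segmentMeanValue`,
# and the PENDANT EXTENSION LEMMA (the free-vertex step of the HAAR induction)

Helper file (`--supports stmt-ValiantsHypothesis-22038`; cell valiant-natproofs, rung V4, 𝒟-side benchmark of
record; seat val-np-p4 gen 23).  Closes NO item.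

The line's open content is `∀ h, SegmentMeanValueAt h` (registered stub `stub_segmentMeanValue`): SOME point table
`P : Fin h → Fin h → ℂ` makes the segment-moment matrix `[segEntry P (u i) (benchCols h r j)]` nonsingular, rows =
ALL `r_h = 1 + h + C(h,2)` subsets `S ⊆ Fin h` with `|S| ≤ 2`, columns = the first `r_h` binary codes `W(r_h)`.

**CONJECTURE HAAR** (this seat; «TNC» in the seat's scripts — renamed to avoid the cell's other acronym).  The ROW family plays no role as long as the columns are an INITIAL SEGMENT of the
binary codes: for every `n` and EVERY injective family of `n` row sets `S_i ⊆ Fin h`, `|S_i| ≤ 2`, some table makes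
`[segEntry P (S i) (benchCols h n j)]_{i,j<n}` nonsingular — the first `n` codes `W(n)` against ANY `n` rows.
Equivalently (generic `P`): in the `r_h × r_h` benchmark matrix with columns in code order, EVERY square submatrix
«any `n` rows × the first `n` columns» is nonsingular — the column flag is totally nonsingular / the functionals
{`δ_0`, segment means over `[0,P_a]`, `[P_a,P_b]`} form a HAAR SYSTEM for the chain of monomial spaces
`𝒫_{W(n)} = span{z^T : code T < n}`: no nonzero polynomial with monomials of code `< n` has zero mean on `n` of the
segments.  `stub_segmentMeanValue` is the instance `n = r_h`, all rows (`segmentMeanValue_of_haar`).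

EVIDENCE (seat folder num/tnc.py, flag.py; exact rank mod `2³¹−1` at random tables): EXHAUSTIVE at `h ≤ 5`
(`h = 5`: all `65 535` pairs (row subset, `W(|subset|)`) nonsingular; `h = 4`: 2 047; `h = 3`: 127), both for the line's
rows and for the loop-free variant (all `h+1` points generic); sampled `h = 6..10` (≈ 5 000 subsets, 0 singular); the
consequence «LU without pivoting succeeds for the full matrix in ANY row order» checked for `h ≤ 18` in several orders
(kit job j313818 extends the census).  WHY IT MIGHT FAIL: a row family supported on few points meeting more low
codes than its span affords — the count `C(u,2)+1 ≤ 2^{u−1}` (rows inside `u` points vs. codes on `u−1` bits) is what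
prevents it, and it is TIGHT at `u = 1, 2, 3`; the variant with loops at every point (`C(u+1,2) > 2^{u−1}` at `u = 2, 3`)
IS singular at `h = 2, 3` for exactly this reason (num/flag2.py), so the conjecture is specific to the line's row set
(at most one point row).  WHY IT IS USEFUL: it turns the `∀h` stub into a statement with a ONE-STEP inductive structure
— from `W(n)` to `W(n+1)` one adds one code and one row, over a hereditary class of row families — instead of the
rigid «one new point = `h` new rows on the irregular window `[r_{h−1}, r_h)`» step whose obstructions the line has
catalogued (Ramanujan–Nagell heights, no one-point toric step through `h = 5 → 6`).  The first move of that induction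
is proved here:

**PENDANT EXTENSION LEMMA** (`pendant_extension`, kernel): if `n` rows are nonsingular on `n` columns `T_j` at a table
`P`, and a new row `{q}` or `{a, q}` brings a NEW point `q`, then for a new column `U` contained in NO `T_j` (e.g. the
next code, `code_succ_not_subset`) the point `q := x·𝟙_U` makes the bordered `(n+1) × (n+1)` matrix nonsingular for
all but finitely many `x` (any field of characteristic zero… here `ℂ`; the old points are NOT assumed generic, so the
lemma iterates along any «pendant ordering» of a row family — paths, stars, matchings, forests).  Proof = the line's
leading-coefficient technique (`…PeelRows`): the new row has `x`-degree `≤ |U|` with top coefficient `[U ⊆ T]·…`,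
nonzero only at the new column, so after scaling the old rows by `x^{|U|}` the top coefficient matrix is block
triangular `[[old, *], [0, |U|!]]`.

WHAT THIS IS NOT: no stub of the line is closed; `Stmt.haar` is a typed CONJECTURE (candidate node, not registered);
the pendant lemma covers only row families with a free vertex at every step (the clique `K_{h+1}` of the stub has none
after its third row); nothing on crux stmt-ValiantsHypothesis-14610 or on `VP` versus `VNP`.
-/

set_option linter.dupNamespace false

namespace Summit.ValiantsHypothesis.ValiantsHypothesis.Theorems.BarrierLever.ChowBenchmarkHaar

open Finset Polynomial
open Summit.ValiantsHypothesis.ValiantsHypothesis.Theorems.BarrierLever.MoorePeel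
  (benchCols benchCols_injective windowStart windowStart_succ_le_two_pow sum_two_pow_benchCols)
open Summit.ValiantsHypothesis.ValiantsHypothesis.Theorems.BarrierLever.ChowBenchmarkDual
  (eq_windowStart_of_enumeration)
open Summit.ValiantsHypothesis.ValiantsHypothesis.Theorems.BarrierLever.ChowBenchmarkPeel
  (segE map_segE coeff_det_of_natDegree_le adjoin indPt symbTable constTable segE_symbTable_old
    natDegree_new_single_le natDegree_new_pair_le coeff_new_single coeff_new_pair)

/-! ## 1. The typed node -/

/-- **CONJECTURE HAAR — total nonsingularity of the segment-moment rows on code segments** (val-np-p4 g23,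
2026-08-28).  For every height `h`, every `n ≤ 2^h` and EVERY injective family `S : Fin n → Finset (Fin h)` of row sets
of size `≤ 2`, some point table makes the square matrix `[segEntry P (S i) (benchCols h n j)]` — the first `n` binary
codes against these `n` rows — nonsingular.  (`n ≤ 2^h` is automatic, `n ≤ r_h ≤ 2^h`; it is kept so that the columns
are literally distinct codes.)  The line's `stub_segmentMeanValue` is the instance «all `r_h` rows»
(`segmentMeanValue_of_haar`). -/
def Stmt.haar : Prop :=
  ∀ (h n : ℕ) (S : Fin n → Finset (Fin h)), Function.Injective S → (∀ i, (S i).card ≤ 2) → n ≤ 2 ^ h →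
    ∃ P : Fin h → Fin h → ℂ,
      (Matrix.of fun i j : Fin n =>
        ∑ g : (↥(benchCols h n j) → ↥(S i)), (∏ c : ↥(benchCols h n j), P (g c) c) *
          ∏ a : ↥(S i), ((Finset.univ.filter fun c : ↥(benchCols h n j) => g c = a).card.factorial : ℂ)).det ≠ 0

/-! ## 2. HAAR ⟹ the line's `stub_segmentMeanValue` -/

/-- **HAAR ⟹ `∀ h, SegmentMeanValueAt h`** (the line file's `Stmt.stub_segmentMeanValue`, unfolded verbatim as in
`ChowBenchmarkDual.stub_dualisation`): the instance `n = r_h`, `S = u` (then `n = c_{h+1} ≤ 2^h`). -/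
theorem segmentMeanValue_of_haar (H : Stmt.haar) : ∀ h : ℕ,
    ∀ (r : ℕ) (u : Fin r → Finset (Fin h)), Function.Injective u → (∀ i, (u i).card ≤ 2) →
      (∀ S : Finset (Fin h), S.card ≤ 2 → ∃ i, u i = S) →
      ∃ P : Fin h → Fin h → ℂ,
        (Matrix.of fun i j : Fin r =>
          ∑ g : (↥(benchCols h r j) → ↥(u i)), (∏ c : ↥(benchCols h r j), P (g c) c) *
            ∏ a : ↥(u i),
              ((Finset.univ.filter fun c : ↥(benchCols h r j) => g c = a).card.factorial : ℂ)).det ≠ 0 := by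
  intro h r u hu hcard hsurj
  have hr : r = windowStart (h + 1) := eq_windowStart_of_enumeration u hu hcard hsurj
  have hr2 : r ≤ 2 ^ h := hr ▸ windowStart_succ_le_two_pow h
  exact H h r u hu hcard hr2

/-- **HAAR ⟹ the free-node benchmark at every height** (compose with the landed `stub_dualisation`). -/
theorem chowBenchPairs_of_haar (H : Stmt.haar) (h : ℕ) :
    ∀ (r : ℕ) (u : Fin r → Finset (Fin h)), Function.Injective u → (∀ i, (u i).card ≤ 2) →
      (∀ S : Finset (Fin h), S.card ≤ 2 → ∃ i, u i = S) →
      ∃ B : Fin h → Fin h → ℂ,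
        (Matrix.of fun i j : Fin r => MvPolynomial.coeff
          (∑ a ∈ u i, Finsupp.single (Fin.castAdd h a) 1 +
            ∑ c ∈ benchCols h r j, Finsupp.single (Fin.natAdd h c) 1)
          (∏ a : Fin h, (MvPolynomial.X (Fin.castAdd h a) + 1 +
            ∑ c : Fin h, MvPolynomial.C (B a c) * MvPolynomial.X (Fin.natAdd h c)))).det ≠ 0 :=
  ChowBenchmarkDual.stub_dualisation h (segmentMeanValue_of_haar H h)

/-! ## 3. The pendant extension lemma -/

section Pendant

variable {κ : Type*} [DecidableEq κ] {n : ℕ} {ι : Type*} [Fintype ι] [DecidableEq ι]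

/-- The new row of a pendant step: the new point alone (`none ↦ {new}`) or together with ONE old point
(`some a ↦ {a, new}`). -/
def pendRow : Option (Fin n) → Finset (Option (Fin n))
  | none => {none}
  | some a => {some a, none}

/-- The rows of the bordered matrix: the old rows `S i` (read in the enlarged point set) and the new row. -/
def bordRow (S : ι → Finset (Fin n)) (o : Option (Fin n)) : ι ⊕ Unit → Finset (Option (Fin n)) :=
  Sum.elim (fun i => (S i).map Function.Embedding.some) (fun _ => pendRow o)

/-- The columns of the bordered matrix: the old columns `T j` and the new column `U`. -/
def bordCol (T : ι → Finset κ) (U : Finset κ) : ι ⊕ Unit → Finset κ :=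
  Sum.elim T (fun _ => U)

/-- The symbolic bordered matrix: old table `P`, new point `X·𝟙_U`, over `ℂ[X]`. -/
noncomputable def bordMatrixX (P : Fin n → κ → ℂ) (S : ι → Finset (Fin n)) (o : Option (Fin n))
    (T : ι → Finset κ) (U : Finset κ) : Matrix (ι ⊕ Unit) (ι ⊕ Unit) ℂ[X] :=
  Matrix.of fun i j => segE (symbTable P U) (bordRow S o i) (bordCol T U j)

/-- Evaluating the symbolic bordered matrix at `x` gives the bordered matrix of the table `P ⊔ {x·𝟙_U}`. -/
theorem eval_det_bordMatrixX (P : Fin n → κ → ℂ) (S : ι → Finset (Fin n)) (o : Option (Fin n))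
    (T : ι → Finset κ) (U : Finset κ) (x : ℂ) :
    (bordMatrixX P S o T U).det.eval x = (Matrix.of fun i j : ι ⊕ Unit =>
      segE (adjoin P (indPt U x)) (bordRow S o i) (bordCol T U j)).det := by
  classical
  have h1 : (Polynomial.evalRingHom x) (bordMatrixX P S o T U).det =
      ((Polynomial.evalRingHom x).mapMatrix (bordMatrixX P S o T U)).det :=
    RingHom.map_det _ _
  rw [Polynomial.coe_evalRingHom] at h1
  rw [h1]
  congr 1
  ext i j
  rw [RingHom.mapMatrix_apply, Matrix.map_apply, bordMatrixX, Matrix.of_apply, Matrix.of_apply,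
    Polynomial.coe_evalRingHom, ← Polynomial.coe_evalRingHom, map_segE]
  congr 1
  funext o' c
  cases o' with
  | none =>
    simp only [symbTable, ChowBenchmarkPeel.adjoin_none, indPt, Polynomial.coe_evalRingHom]
    split_ifs <;> simp
  | some a => simp [symbTable, constTable]

/-- The new row of the symbolic bordered matrix has `X`-degree `≤ |U|`. -/
theorem natDegree_pendRow_le (P : Fin n → κ → ℂ) (U : Finset κ) (o : Option (Fin n)) (T : Finset κ) :
    (segE (symbTable P U) (pendRow o) T).natDegree ≤ U.card := by
  cases o with
  | none => exact natDegree_new_single_le P U T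
  | some a => exact natDegree_new_pair_le P U a T

/-- The `X^{|U|}`-coefficient of the new row VANISHES at a column not containing `U`. -/
theorem coeff_pendRow_of_not_subset (P : Fin n → κ → ℂ) (U : Finset κ) (o : Option (Fin n)) (T : Finset κ)
    (hT : ¬ U ⊆ T) : (segE (symbTable P U) (pendRow o) T).coeff U.card = 0 := by
  cases o with
  | none =>
    rw [pendRow, coeff_new_single, if_neg]
    intro e; exact hT (e ▸ Finset.Subset.refl _)
  | some a => rw [pendRow, coeff_new_pair, if_neg hT]

/-- The `X^{|U|}`-coefficient of the new row at the new column `U` is `|U|!`. -/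
theorem coeff_pendRow_self (P : Fin n → κ → ℂ) (U : Finset κ) (o : Option (Fin n)) :
    (segE (symbTable P U) (pendRow o) U).coeff U.card = (U.card.factorial : ℂ) := by
  cases o with
  | none => rw [pendRow, coeff_new_single, if_pos rfl]
  | some a =>
    rw [pendRow, coeff_new_pair, if_pos (Finset.Subset.refl _), Finset.sdiff_self, Finset.card_empty,
      Nat.factorial_zero, Nat.cast_one, one_mul, Finset.prod_empty, mul_one]

/-- **The determinant of the symbolic bordered matrix is a nonzero polynomial**: if the old matrix is nonsingular at
`P` and the new column `U` is contained in no old column, then `det (bordMatrixX P S o T U) ≠ 0` in `ℂ[X]` (its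
coefficient of `X^{(N+1)|U|}` after scaling the old rows by `X^{|U|}` is `det(old) · |U|!`). -/
theorem det_bordMatrixX_ne_zero (P : Fin n → κ → ℂ) (S : ι → Finset (Fin n)) (o : Option (Fin n))
    (T : ι → Finset κ) (U : Finset κ) (hU : ∀ j, ¬ U ⊆ T j)
    (hold : (Matrix.of fun i j : ι => segE P (S i) (T j)).det ≠ 0) :
    (bordMatrixX P S o T U).det ≠ 0 := by
  classical
  set MX := bordMatrixX P S o T U with hMX0
  have hMX : MX = Matrix.of fun i j => segE (symbTable P U) (bordRow S o i) (bordCol T U j) := rfl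
  -- scale the old rows by `X^|U|`
  set w : ι ⊕ Unit → ℂ[X] := Sum.elim (fun _ => X ^ U.card) (fun _ => 1) with hw
  set MX' : Matrix (ι ⊕ Unit) (ι ⊕ Unit) ℂ[X] := Matrix.of fun i j => w i * MX i j with hMX'
  have hdet' : MX'.det = (∏ i, w i) * MX.det := Matrix.det_mul_column w MX
  suffices hne' : MX'.det ≠ 0 by
    intro h0; apply hne'; rw [hdet', h0, mul_zero]
  -- degrees of the entries
  have hdeg : ∀ i j, (MX' i j).natDegree ≤ U.card := by
    intro i j
    rw [hMX', Matrix.of_apply, hMX, Matrix.of_apply]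
    cases i with
    | inl i =>
      rw [hw, Sum.elim_inl, bordRow, Sum.elim_inl, segE_symbTable_old, mul_comm]
      exact natDegree_C_mul_X_pow_le _ _
    | inr _ =>
      rw [hw, Sum.elim_inr, one_mul, bordRow, Sum.elim_inr]
      exact natDegree_pendRow_le P U o _
  -- the top-coefficient matrix is block triangular
  have htop : (Matrix.of fun i j => (MX' i j).coeff U.card) =
      Matrix.fromBlocks (Matrix.of fun i j : ι => segE P (S i) (T j))
        (Matrix.of fun (i : ι) (_ : Unit) => segE P (S i) U)
        0 (Matrix.of fun _ _ : Unit => (U.card.factorial : ℂ)) := by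
    ext i j
    rcases i with i | i' <;> rcases j with j | j'
    · rw [Matrix.of_apply, Matrix.fromBlocks_apply₁₁, Matrix.of_apply, hMX', Matrix.of_apply, hMX, Matrix.of_apply,
        hw, Sum.elim_inl, bordRow, Sum.elim_inl, bordCol, Sum.elim_inl, segE_symbTable_old, mul_comm,
        coeff_C_mul_X_pow, if_pos rfl]
    · rw [Matrix.of_apply, Matrix.fromBlocks_apply₁₂, Matrix.of_apply, hMX', Matrix.of_apply, hMX, Matrix.of_apply,
        hw, Sum.elim_inl, bordRow, Sum.elim_inl, bordCol, Sum.elim_inr, segE_symbTable_old, mul_comm,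
        coeff_C_mul_X_pow, if_pos rfl]
    · rw [Matrix.of_apply, Matrix.fromBlocks_apply₂₁, Matrix.zero_apply, hMX', Matrix.of_apply, hMX, Matrix.of_apply,
        hw, Sum.elim_inr, one_mul, bordRow, Sum.elim_inr, bordCol, Sum.elim_inl]
      exact coeff_pendRow_of_not_subset P U o (T j) (hU j)
    · rw [Matrix.of_apply, Matrix.fromBlocks_apply₂₂, Matrix.of_apply, hMX', Matrix.of_apply, hMX, Matrix.of_apply,
        hw, Sum.elim_inr, one_mul, bordRow, Sum.elim_inr, bordCol, Sum.elim_inr]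
      exact coeff_pendRow_self P U o
  -- the coefficient of `X^{N |U|}` of `det MX'`
  have hcoeff : MX'.det.coeff (Fintype.card (ι ⊕ Unit) * U.card) ≠ 0 := by
    rw [coeff_det_of_natDegree_le MX' U.card hdeg, htop, Matrix.det_fromBlocks_zero₂₁]
    refine mul_ne_zero hold ?_
    rw [Matrix.det_unique, Matrix.of_apply]
    exact Nat.cast_ne_zero.mpr (Nat.factorial_ne_zero _)
  intro h0
  rw [h0, coeff_zero] at hcoeff
  exact hcoeff rfl

/-- **PENDANT EXTENSION LEMMA, cofinite form.**  If the old `ι × ι` segment-moment matrix `[segE P (S i) (T j)]` is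
nonsingular and the new column `U` lies in no old column, then for all but finitely many `x` the bordered matrix —
old rows + the new row `{new}` (`o = none`) or `{a, new}` (`o = some a`), old columns + `U`, at the table
`P ⊔ {x·𝟙_U}` — is nonsingular. -/
theorem pendant_extension_finite (P : Fin n → κ → ℂ) (S : ι → Finset (Fin n)) (o : Option (Fin n))
    (T : ι → Finset κ) (U : Finset κ) (hU : ∀ j, ¬ U ⊆ T j)
    (hold : (Matrix.of fun i j : ι => segE P (S i) (T j)).det ≠ 0) :
    Set.Finite {x : ℂ | (Matrix.of fun i j : ι ⊕ Unit =>
      segE (adjoin P (indPt U x)) (bordRow S o i) (bordCol T U j)).det = 0} := by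
  have hne := det_bordMatrixX_ne_zero P S o T U hU hold
  refine (Polynomial.finite_setOf_isRoot hne).subset fun x hx => ?_
  rw [Set.mem_setOf_eq, Polynomial.IsRoot.def, eval_det_bordMatrixX]
  exact hx

/-- **PENDANT EXTENSION LEMMA.**  If `n` rows `S i` are nonsingular on `n` columns `T j` at the table `P`, a new row
consisting of a NEW point (alone, or paired with one old point `a`) and a new column `U ⊄ T j` (all `j`) can be
adjoined: for some scalar `x` the bordered `(n+1) × (n+1)` matrix at the table `P ⊔ {x·𝟙_U}` is nonsingular.  The old
points are arbitrary (not assumed generic), so the lemma iterates along any ordering of a row family in which every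
row brings a new point. -/
theorem pendant_extension (P : Fin n → κ → ℂ) (S : ι → Finset (Fin n)) (o : Option (Fin n))
    (T : ι → Finset κ) (U : Finset κ) (hU : ∀ j, ¬ U ⊆ T j)
    (hold : (Matrix.of fun i j : ι => segE P (S i) (T j)).det ≠ 0) :
    ∃ x : ℂ, (Matrix.of fun i j : ι ⊕ Unit =>
      segE (adjoin P (indPt U x)) (bordRow S o i) (bordCol T U j)).det ≠ 0 := by
  have hfin := pendant_extension_finite P S o T U hU hold
  obtain ⟨x, hx⟩ := Set.Infinite.nonempty (Set.Finite.infinite_compl hfin)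
  exact ⟨x, hx⟩

end Pendant

/-! ## 4. The next code is a legitimate new column -/

/-- **The next binary code lies in no earlier one**: for `j < m < r ≤ 2^h`, `benchCols h r m ⊄ benchCols h r j`
(codes are monotone under inclusion of bit-sets).  So in the HAAR induction «`W(m)` → `W(m+1)`» the new column
`T_m = bits(m)` satisfies the hypothesis of `pendant_extension`. -/
theorem benchCols_not_subset_of_lt {h r : ℕ} (hr : r ≤ 2 ^ h) (j m : Fin r) (hjm : j < m) :
    ¬ benchCols h r m ⊆ benchCols h r j := by
  intro hsub
  have hj : (j : ℕ) < 2 ^ h := lt_of_lt_of_le j.2 hr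
  have hm : (m : ℕ) < 2 ^ h := lt_of_lt_of_le m.2 hr
  have hle : ∑ c ∈ benchCols h r m, 2 ^ (c : ℕ) ≤ ∑ c ∈ benchCols h r j, 2 ^ (c : ℕ) :=
    Finset.sum_le_sum_of_subset_of_nonneg hsub fun _ _ _ => Nat.zero_le _
  rw [sum_two_pow_benchCols m hm, sum_two_pow_benchCols j hj] at hle
  exact absurd hle (not_le.mpr hjm)

end Summit.ValiantsHypothesis.ValiantsHypothesis.Theorems.BarrierLever.ChowBenchmarkHaar
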